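import Summits.ABC.IUTFork.ForkGenuineDepthThreshold
import Literature.IUT.LogVolume.TensorPacketHullContainers
import Literature.IUT.LogVolume.TensorPacketLogHolds
import HarnessLib

/-!
# The fork at [IUTchIII] Corollary 3.12 at a GENUINE input: ZERO indeterminacy inflation at an unramified deep prime —
# the intercept of the depth threshold sits entirely at the other support primes (skeleton XXVIId-b)

Record-only file (D-0012) of the abc-iut cell (deliverable (a), skeleton seat abc-iut-skel, gen 8); TAKES NO SIDE.
Sequel to `ForkGenuineDepthThreshold.lean` (XXVIId, p433731: along abc-iut-w5-d157's synthetic family `deepAt p l N σ` the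
genuine `−|log(Θ)|^nonarch` is AFFINE in the depth and `Cor312Of (deepAt N) ↔ N ≤ N₀(p,l,σ)`, with the intercept left as the
depth-one value). HERE the `p`-summand itself is EVALUATED when the deep prime `p` is odd and every genuine completion
`K_{v̲}`, `v | p`, is absolutely unramified — [IUTchIV] Thm. 1.10 Step (vi)'s situation («the “container of possible
images” is precisely equal to» the integral structure), for which abc-iut-S6's `prop12iv_holds` ([IUTchIV] Prop. 1.2 (iv))
and abc-iut-S2's `autImages_normalizedPacket_eq` are in the tree:

* `iUnion_indTwo_smul_smul_normalizedPacket_eq` (packet algebra, `p > 2`, all `e_i = 1`, `|I| ≥ 2`): the (Ind2)-orbit of a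
  SCALAR multiple `c·(R_I)^∼` of the integral structure is `c·(R_I)^∼` itself (the `ℚ_p`-linear lattice automorphisms
  commute with `c` and stabilise `(R_I)^∼` by Prop. 1.2 (iv));
* **`realPrimePacketWith_negLogThetaAt_eq_of_scalar`** (any shell normalisation): a Θ-idele of RATIONAL SCALARS
  `t_{i,v} = p^{n_i}` at such a prime has `−|log(Θ)|_p = −(1/ℓ⋇)·Σ_i n_i·log p` EXACTLY — the hull of the union of the
  possible images of `p^{n}·(R_{v⃗})^∼` is `p^{n}·(R_{v⃗})^∼`, of log-volume `−n·log p`: NO inflation from (Ind1), (Ind2) or the hull;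
* **`negLogThetaLoc_deepAt_eq_of_unramified`** — for the synthetic family: `negLogThetaLoc (deepAt p l N σ) p = −((l+1)l/12)·N·log p`
  (= `−deĝ̲_lgp`-share of `p`, the bare value) at EVERY depth;
* **`cor312Of_deepAt_iff_of_unramified`** — hence the threshold law of XXVIId with the intercept made explicit:
  `Cor312Of (deepAt p l N σ) ↔ ((l+1)l/12 − 1)·N·log p ≤ Σ_{p' ∈ T∖{p}} negLogThetaLoc (deepAt p l 1 σ) p' + ((l+5)/4)·log π` —
  the whole budget that can keep the typed inequality true at depth `N` is the DEPTH-FREE inflation at the OTHER support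
  primes (`2` and the primes ramified in `K`) plus the archimedean term; `negLogThetaNonarch_deepAt_eq_of_unramified` is the
  corresponding closed form of `−|log(Θ)|^nonarch`.

v2 (doc-only): locator of [IUTchIV] Prop. 1.2 (iv) corrected to render p. 11 l. 10 (RQ7 abc-iut-w5-d209 info); no declaration changed.

READING (grammar of `HOME/skel/FORK-REAL-MODEL.md` §4/§9/§10; no side taken): at an unramified deep prime the indeterminacies
of the sharp model contribute NOTHING at any depth; whatever makes the typed inequality of [IUTchIII] Cor. 3.12 hold along the
family beyond the free threshold `((l+1)l/12 − 1)·N·log p ≤ ((l+5)/4)·log π` must come from the primes `2` / ramified in `K`,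
and is bounded independently of `N`. HONEST SCOPE: inhabitants of the INPUT TYPE with genuine completions but SYNTHETIC
ideles, NOT initial Θ-data of [IUTchI] Def. 3.1 (there `K = F(E_F[l])` IS ramified at the bad places); sharp (Ind3), full
(Ind1)/(Ind2), any shell scalar ((Ind2)/the hull are the tree's typings of disputed-corpus constructions). Nothing here bears on
whether [IUTchIII] Thm. 3.11 licenses Cor. 3.12; typed ≠ proved. PROOF-ONLY file: no definitions, no `Prop` facts.
[cite: Mochizuki2012, IUTchIV Prop. 1.2 p. 10, (iv) p. 11, Thm. 1.10 Step (vi) p. 29] [cite: DupuyHilado2025, §1 (1.1), Def. 3.6.3, §3.9,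
§4.7, §4.9, §4.11–4.12] [cite: Mochizuki2012, IUTchIII Cor. 3.12 p. 173–174] [claim: Mochizuki2012, status: disputed]
-/

noncomputable section

open Set Module Literature.IUT.LogVolume NumberField IsDedekindDomain
open scoped Pointwise

namespace Summit.ABC.IUTFork.GenuineContent

/-! ## §1 Packet algebra: the (Ind2)-orbit of a scalar multiple of `(R_I)^∼` at an unramified odd prime -/

section Packet

variable (p : ℕ) [Fact p.Prime] {ι : Type} [Fintype ι] [DecidableEq ι] [Nonempty ι]
variable (k : ι → Type) [∀ i, NontriviallyNormedField (k i)] [∀ i, NormedAlgebra ℚ_[p] (k i)]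
  [∀ i, IsUltrametricDist (k i)] [∀ i, ProperSpace (k i)]

omit [Nonempty ι] in
/-- **The (Ind2)-orbit of `c·(R_I)^∼` is `c·(R_I)^∼`** for `p > 2`, all `e_i = 1`, `|I| ≥ 2` and any scalar `c ∈ ℚ_p`:
every `φ ∈ Aut_{ℚ_p}(V : log_p(R_I^×))` is `ℚ_p`-linear and maps `(R_I)^∼` into the union of its possible images, which is
`(R_I)^∼` by [IUTchIV] Prop. 1.2 (iv) (abc-iut-S6's `prop12iv_holds`, abc-iut-S2's `autImages_normalizedPacket_eq`).
[cite: Mochizuki2012, IUTchIV Prop. 1.2 p. 10, (iv) p. 11, Thm. 1.10 Step (vi) p. 29] -/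
theorem iUnion_indTwo_smul_smul_normalizedPacket_eq (hI : 2 ≤ Fintype.card ι) (hp2 : 2 < p)
    (he : ∀ i, absRamificationIdx p (k i) = 1) (c : ℚ_[p]) :
    (⋃ g : indTwo p k, g • (c • (normalizedPacket p k : Set (PacketAlgebra p k)))) =
      c • (normalizedPacket p k : Set (PacketAlgebra p k)) := by
  refine le_antisymm (Set.iUnion_subset fun g => ?_) fun x hx => Set.mem_iUnion.mpr ⟨1, by rwa [one_smul]⟩
  intro x hx
  obtain ⟨z, hz, rfl⟩ := Set.mem_smul_set.mp hx
  obtain ⟨y, hy, rfl⟩ := Set.mem_smul_set.mp hz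
  have hgy : (g : PacketAlgebra p k ≃ₗ[ℚ_[p]] PacketAlgebra p k) y ∈
      (normalizedPacket p k : Set (PacketAlgebra p k)) := by
    have h : (g : PacketAlgebra p k ≃ₗ[ℚ_[p]] PacketAlgebra p k) y ∈
        autImages p k (normalizedPacket p k : Set (PacketAlgebra p k)) :=
      (mem_autImages_iff p k).mpr ⟨g, isLogPacketAut_of_mem p k g.2, y, hy, rfl⟩
    rwa [autImages_normalizedPacket_eq p k (prop12iv_holds p k) hI hp2 he] at h
  refine Set.mem_smul_set.mpr ⟨(g : PacketAlgebra p k ≃ₗ[ℚ_[p]] PacketAlgebra p k) y, hgy, ?_⟩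
  rw [Subgroup.smul_def, LinearEquiv.smul_def, LinearEquiv.map_smul]

end Packet

/-! ## §2 A Θ-idele of rational scalars at an unramified odd prime: `−|log(Θ)|_p` exactly -/

section Scalar

variable {F : Type} [Field F] [NumberField F]
variable (p : ℕ) [hp : Fact p.Prime] (𝔽 : LocalFields F p)
variable (c : (j : ℕ) → (Fin (j + 1) → placesOver F p) → ℚ_[p]) (hc0 : ∀ j e, c j e ≠ 0)
  (hcσ : ∀ (j : ℕ) (σ : Equiv.Perm (Fin (j + 1))) (e : Fin (j + 1) → placesOver F p), c j (e ∘ σ) = c j e)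

/-- **ZERO INFLATION for a Θ-idele of rational scalars at an unramified odd prime** (real packet, ANY shell scalar `c`): if
`p > 2`, every `K_v` (`v | p`) is absolutely unramified and `t_{i,v} = p^{n_i}` for all `v | p`, then
`−|log(Θ)|_p = (1/ℓ⋇)·Σ_i (−n_i·log p)` — at every summand the possible images of `p^{n_i}·(R_{v⃗})^∼` under (Ind1)/(Ind2) are
`p^{n_i}·(R_{v⃗})^∼`, its own hull, of log-volume `−n_i·log p`, and `Σ_{v⃗} Π Pr(v_b) = 1`.
[cite: Mochizuki2012, IUTchIV Thm. 1.10 Step (vi) p. 29] [cite: DupuyHilado2025, Def. 3.6.3, §4.11–4.12] [claim: Mochizuki2012, status: disputed] -/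
theorem realPrimePacketWith_negLogThetaAt_eq_of_scalar (hp2 : 2 < p)
    (he : ∀ v : placesOver F p, absRamificationIdx p (𝔽.k v) = 1) {lstar : ℕ}
    (t : Fin lstar → (v : placesOver F p) → (𝔽.k v)ˣ) (n : Fin lstar → ℕ)
    (ht : ∀ (i : Fin lstar) (v : placesOver F p), (t i v : 𝔽.k v) = algebraMap ℚ_[p] (𝔽.k v) ((p : ℚ_[p]) ^ n i)) :
    (realPrimePacketWith p 𝔽 c hc0 hcσ).negLogThetaAt lstar t =
      (1 / (lstar : ℝ)) * ∑ i : Fin lstar, -((n i : ℝ) * Real.log p) := by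
  classical
  have hsum : ∑ v : placesOver F p, weight F v.1 = 1 := (localWeights F p).sum_pr
  have hW : ∀ m : ℕ, ∑ e : Fin m → placesOver F p, ∏ b, weight F (e b).1 = 1 := by
    intro m
    have h := Finset.prod_univ_sum (t := fun _ : Fin m => (Finset.univ : Finset (placesOver F p)))
      (f := fun _ v => weight F v.1)
    rw [Fintype.piFinset_univ] at h
    rw [← h, hsum, Finset.prod_const_one]
  -- per summand: hull of the possible images = `p^{n_i}·(R_{v⃗})^∼`, log-volume `−n_i·log p`
  have hval : ∀ (i : Fin lstar) (e : Fin ((i : ℕ) + 1 + 1) → placesOver F p),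
      (realPrimePacketWith p 𝔽 c hc0 hcσ).logμ ((realPrimePacketWith p 𝔽 c hc0 hcσ).possibleImagesHull
        ((realPrimePacketWith p 𝔽 c hc0 hcσ).pilotRegion t) ((i : ℕ) + 1) e) = -((n i : ℝ) * Real.log p) := by
    intro i e
    have hI : 2 ≤ Fintype.card (Fin ((i : ℕ) + 1 + 1)) := by simp
    change packetLogμ p (fun b => 𝔽.k (e b)) (packetHull p (fun b => 𝔽.k (e b))
      ((realPrimePacketWith p 𝔽 c hc0 hcσ).possibleImages
        ((realPrimePacketWith p 𝔽 c hc0 hcσ).pilotRegion t) ((i : ℕ) + 1) e)) = _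
    rw [realPrimePacketWith_possibleImages_pilotRegion_eq p 𝔽 c hc0 hcσ t i e,
      iUnion_iota_smul_eq_smul_of_eq_algebraMap p (fun b => 𝔽.k (e b)) ((p : ℚ_[p]) ^ n i) _
        (fun a => ht i (e a)) _,
      iUnion_indTwo_smul_smul_normalizedPacket_eq p (fun b => 𝔽.k (e b)) hI hp2 (fun b => he (e b)) _,
      ← zpow_natCast, ← ppow_smul_set_eq, packetHull_smul_normalizedPacket,
      packetLogμ_ppow_smul p _ _ (packetAdm_normalizedPacket p _), packetLogμ_normalizedPacket, add_zero]
    push_cast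
    ring
  unfold PrimePacket.negLogThetaAt PrimePacket.lnνLp PrimePacket.lnνTensorPower
  refine congrArg (fun x : ℝ => (1 / (lstar : ℝ)) * x) (Finset.sum_congr rfl fun i _ => ?_)
  rw [Finset.sum_congr rfl fun e _ => by rw [hval i e], ← Finset.mul_sum, hW, mul_one]

end Scalar

/-! ## §3 The synthetic family at an unramified odd deep prime: the intercept made explicit -/

section DepthZero

variable {F₀ : Type} [Field F₀] [NumberField F₀] {K : Type} [Field K] [NumberField K] [Algebra F₀ K]
variable (p : ℕ) [hp : Fact p.Prime] (l : ℕ) (hl : l.Prime) (h5 : 5 ≤ l) (σ : PlaceSection F₀ K)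

/-- **ZERO INFLATION AT THE DEEP PRIME, every depth**: if `p > 2` and every genuine completion `K_{v̲}` (`v | p`) is absolutely
unramified, then `negLogThetaLoc (deepAt p l N σ) p = −((l+1)l/12)·N·log p` — the bare value `−(1/ℓ⋇)Σ_j j²N·log p`; (Ind1), (Ind2)
and the hull add nothing at `p`. [cite: Mochizuki2012, IUTchIV Thm. 1.10 Step (vi) p. 29] [cite: DupuyHilado2025, §1 (1.1), Def. 3.6.3]
[claim: Mochizuki2012, status: disputed] -/
theorem negLogThetaLoc_deepAt_eq_of_unramified (hp2 : 2 < p)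
    (hunram : ∀ v : placesOver F₀ p, absRamificationIdx p ((σ.localFieldFamily p hp.out).k v) = 1) (N : ℕ) (hN : 0 < N) :
    (ThetaVolumeInput.deepAt p l hl h5 N hN σ).negLogThetaLoc p = -(((l : ℝ) + 1) * l / 12 * ((N : ℝ) * Real.log p)) := by
  rw [(ThetaVolumeInput.deepAt p l hl h5 N hN σ).negLogThetaLoc_of_prime hp.out]
  have h := realPrimePacketWith_negLogThetaAt_eq_of_scalar p
    ((ThetaVolumeInput.deepAt p l hl h5 N hN σ).σ.localFieldFamily p hp.out)
    (mScale p ((ThetaVolumeInput.deepAt p l hl h5 N hN σ).σ.localFieldFamily p hp.out))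
    (mScale_ne_zero p ((ThetaVolumeInput.deepAt p l hl h5 N hN σ).σ.localFieldFamily p hp.out))
    (mScale_perm p ((ThetaVolumeInput.deepAt p l hl h5 N hN σ).σ.localFieldFamily p hp.out)) hp2 hunram
    ((ThetaVolumeInput.deepAt p l hl h5 N hN σ).tΘ p hp.out) (fun i => ((i : ℕ) + 1) ^ 2 * N)
    (fun i v => coe_tΘ_deepAt p l hl h5 σ N hN i v)
  refine h.trans ?_
  change (1 / (((l - 1) / 2 : ℕ) : ℝ)) * ∑ i : Fin ((l - 1) / 2), -((((((i : ℕ) + 1) ^ 2 * N : ℕ) : ℕ) : ℝ) * Real.log p) = _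
  have hfac : ∑ i : Fin ((l - 1) / 2), -((((((i : ℕ) + 1) ^ 2 * N : ℕ) : ℕ) : ℝ) * Real.log p) =
      -(((N : ℝ) * Real.log p) * ∑ i : Fin ((l - 1) / 2), (((i : ℕ) : ℝ) + 1) ^ 2) := by
    rw [Finset.mul_sum, ← Finset.sum_neg_distrib]
    exact Finset.sum_congr rfl fun i _ => by push_cast; ring
  rw [hfac, mul_neg, mul_left_comm, avg_sum_sq_eq l hl h5]
  ring

/-- **`−|log(Θ)|^nonarch` along the family, closed form at an unramified odd deep prime**:
`negLogThetaNonarch (deepAt p l N σ) = −((l+1)l/12)·N·log p + Σ_{p' ∈ T∖{p}} negLogThetaLoc (deepAt p l 1 σ) p'` — the second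
term (the inflation at `2` and at the primes ramified in `K`) does not depend on `N`.
[cite: DupuyHilado2025, §1 (1.1), Def. 3.6.3] [claim: Mochizuki2012, status: disputed] -/
theorem negLogThetaNonarch_deepAt_eq_of_unramified (hp2 : 2 < p)
    (hunram : ∀ v : placesOver F₀ p, absRamificationIdx p ((σ.localFieldFamily p hp.out).k v) = 1) (N : ℕ) (hN : 0 < N) :
    (ThetaVolumeInput.deepAt p l hl h5 N hN σ).negLogThetaNonarch =
      -(((l : ℝ) + 1) * l / 12 * ((N : ℝ) * Real.log p)) +
        ∑ p' ∈ (ThetaVolumeInput.deepAt p l hl h5 1 Nat.one_pos σ).supportPrimes.erase p,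
          (ThetaVolumeInput.deepAt p l hl h5 1 Nat.one_pos σ).negLogThetaLoc p' := by
  classical
  have h1 := negLogThetaNonarch_deepAt_sub p l hl h5 σ N 1 hN Nat.one_pos
  have h2 : (ThetaVolumeInput.deepAt p l hl h5 1 Nat.one_pos σ).negLogThetaNonarch =
      (ThetaVolumeInput.deepAt p l hl h5 1 Nat.one_pos σ).negLogThetaLoc p +
        ∑ p' ∈ (ThetaVolumeInput.deepAt p l hl h5 1 Nat.one_pos σ).supportPrimes.erase p,
          (ThetaVolumeInput.deepAt p l hl h5 1 Nat.one_pos σ).negLogThetaLoc p' :=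
    (Finset.add_sum_erase _ _ (mem_supportPrimes_deepAt p l hl h5 σ 1 Nat.one_pos)).symm
  have h3 := negLogThetaLoc_deepAt_eq_of_unramified p l hl h5 σ hp2 hunram 1 Nat.one_pos
  push_cast at h1 h3
  linarith

/-- **THE THRESHOLD WITH ITS INTERCEPT, at an unramified odd deep prime**: for every `F₀, K, σ`, prime `l ≥ 5`, odd prime `p` with
all `K_{v̲}` (`v | p`) absolutely unramified, and every depth `N ≥ 1`,
`Cor312Of (deepAt p l N σ) ↔ ((l+1)l/12 − 1)·N·log p ≤ Σ_{p' ∈ T∖{p}} negLogThetaLoc (deepAt p l 1 σ) p' + ((l+5)/4)·log π`: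
the budget is the depth-free inflation at the OTHER support primes plus the archimedean term. HYPOTHESIS-shaped on the left;
synthetic input; no side taken. [cite: Mochizuki2012, IUTchIII Cor. 3.12 p. 173–174] [cite: Mochizuki2012, IUTchIV Thm. 1.10 Step (vi)–(vii) p. 29–30]
[claim: Mochizuki2012, status: disputed] -/
theorem cor312Of_deepAt_iff_of_unramified (hp2 : 2 < p)
    (hunram : ∀ v : placesOver F₀ p, absRamificationIdx p ((σ.localFieldFamily p hp.out).k v) = 1) (N : ℕ) (hN : 0 < N) :
    (ThetaVolumeInput.deepAt p l hl h5 N hN σ).Cor312Of ↔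
      (((l : ℝ) + 1) * l / 12 - 1) * ((N : ℝ) * Real.log p) ≤
        (∑ p' ∈ (ThetaVolumeInput.deepAt p l hl h5 1 Nat.one_pos σ).supportPrimes.erase p,
          (ThetaVolumeInput.deepAt p l hl h5 1 Nat.one_pos σ).negLogThetaLoc p') + ThetaVolumeInput.archLogTheta l := by
  unfold ThetaVolumeInput.Cor312Of ThetaVolumeInput.negLogTheta
  rw [ThetaVolumeInput.deepAt_negAbsLogQ' p l hl h5 N hN σ,
    negLogThetaNonarch_deepAt_eq_of_unramified p l hl h5 σ hp2 hunram N hN]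
  change _ ≤ _ + ThetaVolumeInput.archLogTheta l ↔ _
  constructor <;> intro h <;> linarith

end DepthZero

end Summit.ABC.IUTFork.GenuineContent

end
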